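import Summits.BirchSwinnertonDyer.BirchSwinnertonDyer.Theorems.ByReductionTypeAtTwoMultTransportTwistedDescentDualInfinity
import HarnessLib

/-!
# T-42 in the kernel, generic twisted descent (LXV-i): the ∀-wrappers of file `…TwistedDescentDualInfinity` with a
# PREDICATE `R` in place of the threaded binder `W.HasMultiplicativeReductionAtPrime 2`

Cell `bsd-2adic` (run/shared/lean/pub/bsd-2adic/), seat `bsd-2adic-t42` (BRIEF-T42), GEN 29 (memo
`t42/DESIGN-T42-ADDENDUM-33.md`, «F3a road»: Matsuno's Lemma 4.5 (i) at a GOOD ORDINARY `2` as a kernel theorem).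
HONEST FRAMING: research route; THEOREMS ONLY (no `def`, no named fact, no instance); nothing booked; nothing re-keyed;
BSD is not proved by any of this. PARTITION: X5@2 GV-transport rows whose REFERENCE curve is GOOD ORDINARY at `2`
(K4ᵐ B1·O1 `MultCongruenceTransportAtTwo`; the binder `hF3a` of p744459) × p = 2 — types-the-object-of; bears_on K4 items
19922 / 19923 (`--supports stmt-BirchSwinnertonDyer-19923`).

## What

In files XIV–XXX of the multiplicative road (`hF3b`), the reduction hypothesis `W.HasMultiplicativeReductionAtPrime 2`
of the ∀-statements `LIFT`, `LIFT₁`, `LIFT₂`, `LIFT₃`, `T2`, `δ2`, `δinf` and of the conclusion is only THREADED — it is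
consumed by the two local inputs at the end of the chain (the Tate-line package at `2`), never by the wrappers. This file
re-lands the wrappers of `…TwistedDescentDualInfinity` with an arbitrary predicate
`R : ∀ (W : WeierstrassCurve ℚ) [W.IsElliptic] [W.IsGloballyMinimal], Prop` in place of that binder (names suffixed
`_R`, `R` the first explicit argument; statements and proofs otherwise VERBATIM). Instantiated at
`R W := IsOrdinaryAt W 2` with the good-ordinary local inputs (`…TwistedDescentOrdLinePackage`, `…OrdT2Final`) the
chain yields `Matsuno2008.lemma45i_noFiniteSubmodule_nonPrimitive_goodOrd_two` from Greenberg's Prop. 4.9; at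
`R W := W.HasMultiplicativeReductionAtPrime 2` it is the original chain.

Declarations: `dualKummerAtInfinity_R`.

References: [GreenbergLNM1716] §4 Lemma 4.6, Prop. 4.9, Props. 4.13–4.15 (pp. 105–126); [GreenbergVatsal2000] §2 pp. 14–17;
[MilneADT2006] I Thm. 4.10, Cor. 2.3.
-/


set_option autoImplicit false
set_option linter.dupNamespace false

noncomputable section

open scoped Classical ContRepresentation

universe u

namespace Summit.BirchSwinnertonDyer.BirchSwinnertonDyer.Theorems.MultTransportTwistedDescent

open NumberField IsDedekindDomain Field WeierstrassCurve CategoryTheory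
  Literature.NumberTheory.EllipticCurves Literature.NumberTheory.EllipticCurves.GreenbergVatsal2000
  Literature.NumberTheory.GaloisRepresentations Literature.NumberTheory.GaloisCohomology
open Literature.NumberTheory.GaloisRepresentations.DiscreteGaloisModule (localTatePairingZMod localTatePairing
  tateDualPairingLocal unramifiedSubgroup SelmerStructure TateDual mu tateDualEval)

/-- **`δinf`: the dual Kummer condition at a real place of `ℚ`** — the hypothesis of
`levelTarget_of_local_alt_R` (file XXIV′ `…TwistedDescentLocalAlt.lean`), verbatim; from
`twistedTorsionToLocalH1_eq_zero_of_dual_infinitePlace`. [cite: MilneADT2006, Ch. I, Rem. 3.7 and Lemma 6.15]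
[cite: GreenbergLNM1716, §4 p. 109] -/
theorem dualKummerAtInfinity_R (R : ∀ (W : WeierstrassCurve ℚ) [W.IsElliptic] [W.IsGloballyMinimal], Prop) :
    ∀ (W : WeierstrassCurve ℚ) [W.IsElliptic] [W.IsGloballyMinimal],
      R W →
      ∀ (κ : ZpExtension ℚ 2) (_hκ : κ.IsCyclotomic) (J : ℕ) (u u' : ℤ) (hu : (2 : ℤ) ∣ u - 1)
        (hu' : (2 : ℤ) ∣ u' - 1) (huu' : ((2 : ℤ) ^ J) ∣ u * u' - 1)
        (e : W.geomTorsion ((2 ^ J : ℕ) : ℤ) → W.geomTorsion ((2 ^ J : ℕ) : ℤ) → AlgebraicClosure ℚ)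
        (hμ : ∀ S T, e S T ^ (2 ^ J) = 1)
        (hadd₁ : ∀ S₁ S₂ T, e (S₁ + S₂) T = e S₁ T * e S₂ T)
        (hadd₂ : ∀ S T₁ T₂, e S (T₁ + T₂) = e S T₁ * e S T₂)
        (hgal : ∀ (σ : absoluteGaloisGroup ℚ) (S T : W.geomTorsion ((2 ^ J : ℕ) : ℤ)),
          σ • e S T = e (σ • S) (σ • T))
        (_halt : ∀ T, e T T = 1) (_hnondeg : ∀ T, (∀ S, e S T = 1) → T = 0),
      ∀ [Finite (W.geomTorsion ((2 ^ J : ℕ) : ℤ))],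
      ∀ (w : InfinitePlace ℚ)
        (ιw : galoisCohomology ((DiscreteGaloisModule.mu ℚ (2 ^ J)).toLocal (Sum.inl w)) 2 →+ ZMod (2 ^ J)),
        Function.Injective ιw →
      ∀ (y' : galoisCohomology ((W.twistedTorsionGaloisModule 2 κ J u' hu').restrictField w.Completion) 1),
        (∀ a : galoisCohomology ((W.twistedTorsionGaloisModule 2 κ J u hu).restrictField w.Completion) 1,
          W.twistedTorsionToLocalH1 2 κ J u hu w.Completion a = 0 →
          localTatePairingZMod (W.twistedTorsionGaloisModule 2 κ J u hu) (2 ^ J) (Sum.inl w) ιw a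
            (galoisCohomology.map
              ((W.twistedWeilDual 2 κ J hu hu' huu' e hμ hadd₁ hadd₂ hgal).restrictField w.Completion)
              1 y') = 0) →
        W.twistedTorsionToLocalH1 2 κ J u' hu' w.Completion y' = 0 :=
  fun W _ _ _ κ _ J _ _ hu hu' huu' e hμ hadd₁ hadd₂ hgal halt hnondeg _ w ιw hι y' H ↦
    twistedTorsionToLocalH1_eq_zero_of_dual_infinitePlace W 2 κ J hu hu' huu' e hμ hadd₁ hadd₂ hgal halt hnondeg
      w ιw hι y' H

end Summit.BirchSwinnertonDyer.BirchSwinnertonDyer.Theorems.MultTransportTwistedDescent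

end
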